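import Summits.QuantumFields.YangMills.Theorems.BalabanUVNodesN15TwoGridCovariantDefectGauge
import Summits.QuantumFields.YangMills.Theorems.BalabanUVNodesN15CovariantTwoGridPullback
import HarnessLib

/-!
# N15 = NE2, road (c) — PROGRAMME (PC) «[B9] Sect. C FOR THE LANDAU LETTER WITH PER-CUBE GAUGES (3.35) AS PRINTED», (PC-E): THE COVARIANT η-DEFECT IS THE TWIST OF A FLAT
# η-DEFECT — `𝔇_{τ_{U′}}(A′(U′), A(U)) = M_{W_hᵀ} · 𝔇_{pull}(A′(U′^{h}), A(U))` EXACTLY, `h` the staircase holonomy of `U′` (the relative axial gauge), and the commutator form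
# `𝔇_{τ_{U′}} = (A′M_{W_hᵀ} − M_{W_hᵀ}A′)·pull + M_{W_hᵀ}·𝔇_{pull}(A′(U′), A(U))` (dag-n15-c g31, n15-c∕331)

Cell `pub-ymgap`, seat `pub-ymgap-dag-n15-c` (generation g31; R134 (a) seat, strategy s1 «first missing estimate»; HUMAN RULING D-0062; chair R424 venue).
`bears_on: R4∕N15 · K3⁸ SpineGivenEndpointR13SepCoPHV (stmt-QuantumFields-27366)`; filed `--kind proof --supports stmt-QuantumFields-27366 --as helper` — COUNT-NEUTRAL.
Ten theorems, 0 `def`, 0 `sorry`; ALGEBRA over landed objects, NO estimate.  Imports BY NAME n15-c∕330 `…TwoGridCovariantDefectGauge` (`cvOp'_gauge`: `M_W A′(U′) M_{Wᵀ} = A′(U′^{u})`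
on the fine grid; through it the two grids' bond objects and pub-balaban's `idef`) and dag-n15-a g37 `…N15CovariantTwoGridPullback` (✓p793026: the COVARIANT two-grid pull-back
`ctauV M L k m T′ = mmulOp (kingStairT … T′ ·)ᵀ ∘ pull (liftMap (kingPrV L k m M) ι)`, `kingStairT`, `kingStairT_conj`; director-ym RULING I.20786: TRANSPORT = COVARIANT).  Through
the closure: n15-c `CovAvg.conjTranspose_mprod_mul_self`, dag-n15-w2 `uN_coordMat_conj_orthogonal`, n15-w3 `mmulOp_transpose_comp`.  Nothing in the tree is modified, no landed name
re-declared.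

WHY (`PCE-DESIGN-g31.md` §2–§3, design of record).  n15-c∕328 reduced (PC-E) for the propagator to the η-defect of Bałaban's OPERATOR through arbitrary transports; n15-c∕330 showed
that defect is gauge-covariant when the transports are; dag-n15-a's `ctauV` IS the covariant transport of the ruling and has the product form `M_{Sᵀ} ∘ pull` with `S` the
staircase transporter field of `U′` from the King base point `σ(πx′)`.  THIS FILE draws the consequence that organises the remaining estimate: for a `U(m)`-valued SITE bond
field `U′` on the fine torus, `S = Ad(h)` with `h(x′)` the staircase HOLONOMY (a unitary site field, `kingStairT_conj` + unitarity of products), so by one line of algebra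
(§1 `idef_factor`: `𝔇_{Pπ}(X′, X) = P·𝔇_π(QX′P, X)` when `PQ = 1`) and the fine gauge law (330 `cvOp'_gauge` at `u := h`)
    `𝔇_{τ_{U′}}(A′(U′), A(U)) = M_{Ad(h)ᵀ} · 𝔇_{pull}(A′(U′^{h}), A(U))`   (§3 ★★★ `idef_ctauV_cvOp_eq_twist`)
— the COVARIANT η-defect of the design of record IS, exactly, the orthogonal twist of the FLAT (King `pull`) η-defect between the coarse field `U` (untouched) and the fine field
put in the RELATIVE AXIAL GAUGE `U′^{h}` (all staircase transporters from the base points trivial).  Block majorants pass through the twist at the cost `|ι|` (330 §4's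
sandwich).  So the flat two-grid vocabulary of the lane (n15-c∕235–258, 324∕326, dag-n15-a's `kingPr` rows) is NOT discarded by the ruling: what the pure-gauge witness of the
memo kills is only its application to the RAW pair `(U′, U)`; for the witness (`U′ = δu′`, `U = 1`) one has `U′^{h} = 1` and §3 returns the twisted King defect.  CAVEAT
(memo §5): the relatively gauged field `U′^{h}` is not fine-scale smooth, and the operator-level defect of the difference-operator parts of `A` is `O(η′⁻²)` in block norm for
any transport — the η-smallness of (PC-E) is taken KING-STYLE at the propagator entries through the two-grid random walk (dag-n15-w3 53 ∕ `idef_fix`), piece by piece in cube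
gauge pairs.  For that the PROPAGATOR-LEVEL split (§4 ★★ `idef_ctauV_eq_flat_add`, any bounded `X′, X`, any `T′`) `𝔇_{τ} = 𝔇_{pull} + X′(M_{Sᵀ} − 1)pull − (M_{Sᵀ} − 1)pull X`
is the working form: its extra factor `(M_{Sᵀ} − 1)∘pull` IS dag-n15-a's `ctauV − pull`, whose block letter is LANDED (✓p793284 `…CovariantTwoGridPullbackSizes.hasMaj_ctauV_sub_pull`,
`≤ (1+ρ)^{(d+1)(L^r−1)} − 1 = O(L^r·η′·|A′|) = O(η|A′|)` in a smooth cube gauge), with NO derivative of `S`; the COMMUTATOR form (§4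
`idef_ctauV_eq_comm`) is recorded for completeness only (pushing `M_{Sᵀ}` through `A′` produces `∇S = O(|A′|)`, not small).

WHAT THIS FILE PROVES (kernel).
* §1 [folklore] `idef_factor` (`𝔇_{P₁π₁, P₂π₂}(X′, X) = P₂ ∘ 𝔇_{π₁,π₂}(Q₂X′P₁, X)` if `P₂Q₂ = 1`), `idef_factor_comm` (`= (X′P₁ − P₂X′)π₁ + P₂ ∘ 𝔇_{π₁,π₂}(X′, X)`).
* §2 `kingStairT_fst` (the staircase transporter of a ν-blind datum is ν-blind, `rfl`), `kingStairT_conjTranspose_mul_self` (staircase holonomies of unitaries are unitary).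
* §3 ★★★ `idef_ctauV_cvOp_eq_twist` (displayed formula above; `A`, `A′` = Bałaban's full bond operators of n15-c∕328∕330 with free spacing parameters `η, η′` and masses `a, a′`;
  `U` any coarse bond-point field; `U′ = U₀′ ∘ fst` a unitary site bond field).
* §5 ★★★ `idef_ctauV_conj_split` (the PER-PIECE INTERFACE of the two-grid random walk: covariant defect of gauge-conjugated pieces `M_{W′ᵀ}X′M_{W′}`, `M_{(W′∘σ)ᵀ}XM_{W′∘σ}` =
  `M_{W′ᵀ} ∘ [𝔇_{pull}(X′, X) + X′(M_{S^{W′ᵀ}} − 1)pull − (M_{S^{W′ᵀ}} − 1)pull X] ∘ M_{W′∘σ}`, any bounded `X′, X`), with the dictionary `ctauV_eq_conj_gaugeTb`.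
* §4 ★★ `idef_ctauV_eq_comm` (the commutator form, any `T′`), ★★ `idef_ctauV_eq_flat_add` (the propagator-level form `𝔇_τ = 𝔇_pull + X′(M−1)pull − (M−1)pull X`,
  §1 `idef_mul_split`), and `ctauV_cvT_eq` (`τ_{U′} = M_{Ad(h)ᵀ} ∘ pull` for site bond fields, the dictionary used in §3).

HONEST FRAMING ∕ LIMITS.  Exact algebra; no estimate, no pairing relation between `U` and `U′`; MODEL carriers (doubled-cube torus cover, one averaging level, unit weights,
trace-form colour coordinates); [Balaban1985BackgroundPropagators] (3.34)–(3.35) p.396, Thm 3.14 pp.426–427, [Balaban1985Averaging] (125) p.36 (staircase transports) and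
[King1986] p.664 (pairing) = SHAPES ∕ MECHANISM, nothing printed is asserted.  NE2⁺ NOT PRINTED, NOT proved; N15 of record untouched (DISCHARGED AS CONSUMED, p687738); K3⁸ OPEN;
counts of record UNMOVED (typed 28∕28 · discharged 8∕27); one finite 𝕋⁴ at fixed ε per index — NOT infinite volume, NOT OS on ℝ⁴, NOT a mass gap, NOT Clay; R4 closes the
conditional finite-𝕋⁴ rung `BalabanLadder.UV` only.  Restate-immune (no Theses import).
-/

noncomputable section

open scoped BigOperators Matrix Matrix.Norms.L2Operator

namespace Summit.QuantumFields.YangMills.BalabanUVNodes.N15.Gluing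

open Real
open Literature.MathematicalPhysics.QuantumFieldTheory.Balaban1983to89
open Literature.MathematicalPhysics.QuantumFieldTheory.Balaban1983to89.B5Prop11Plancherel (Tor fine unitVec)
open Literature.MathematicalPhysics.QuantumFieldTheory.Balaban1983to89.B11SectG (BlockNorm HasMaj)
open Literature.MathematicalPhysics.QuantumFieldTheory.Balaban1983to89.B6UnitTorusCarrier (unitTorusGeo)
open Literature.MathematicalPhysics.QuantumFieldTheory.Balaban1983to89.T4EtaRateDefect (idef)
open Literature.MathematicalPhysics.QuantumFieldTheory.Balaban1983to89.T4EtaRateCoeffDefect (pull)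
open Literature.MathematicalPhysics.QuantumFieldTheory.King1986.Torus (blockOf)
open Literature.Barriers.QuantumFields (traceForm)
open Summit.QuantumFields.YangMills.BalabanUVNodes.N15.BackgroundLayer (covLapM)
open Summit.QuantumFields.YangMills.BalabanUVNodes.N15.MatrixSpecies (mmulOp coordMat liftBlk liftMap)
open Summit.QuantumFields.YangMills.BalabanUVNodes.N15.VectorPiece (bshiftEquiv kingPrV)
open Summit.QuantumFields.YangMills.BalabanUVNodes.N15.CurvedSpecies (gaugePair uN_coordMat_conj_orthogonal mmulOp_transpose_comp)
open Summit.QuantumFields.YangMills.BalabanUVNodes.N15.CovAvg (mprod mprod_congr conjTranspose_mprod_mul_self kingStairT kingLineT kingStairT_conj ctauV kingSec)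
open Summit.QuantumFields.YangMills.BalabanUVNodes.N15.CovLandau (gaugeTb)

variable {d : ℕ} {L : ℕ} [NeZero L]

/-! ## §1 Factoring a multiplier out of the transports -/

section Algebra

variable {F₁ F₂ F₁' F₂' : Type} [AddCommGroup F₁] [Module ℝ F₁] [AddCommGroup F₂] [Module ℝ F₂] [AddCommGroup F₁'] [Module ℝ F₁'] [AddCommGroup F₂'] [Module ℝ F₂']

/-- `𝔇_{P₁π₁, P₂π₂}(X′, X) = P₂ ∘ 𝔇_{π₁, π₂}(Q₂X′P₁, X)` when `P₂Q₂ = 1`: a left-invertible multiplier in the transports moves onto the fine operator as a conjugation. [folklore] -/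
theorem idef_factor (π₁ : F₁ →ₗ[ℝ] F₁') (π₂ : F₂ →ₗ[ℝ] F₂') (P₁ : F₁' →ₗ[ℝ] F₁') (P₂ Q₂ : F₂' →ₗ[ℝ] F₂') (X' : F₁' →ₗ[ℝ] F₂') (X : F₁ →ₗ[ℝ] F₂)
    (h : P₂ ∘ₗ Q₂ = LinearMap.id) :
    idef (P₁ ∘ₗ π₁) (P₂ ∘ₗ π₂) X' X = P₂ ∘ₗ idef π₁ π₂ (Q₂ ∘ₗ X' ∘ₗ P₁) X := by
  have e2 : ∀ x, P₂ (Q₂ x) = x := fun x => by simpa using LinearMap.congr_fun h x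
  ext μ
  simp [idef, map_sub, e2]

/-- The commutator form: `𝔇_{P₁π₁, P₂π₂}(X′, X) = (X′P₁ − P₂X′)∘π₁ + P₂ ∘ 𝔇_{π₁, π₂}(X′, X)` (no invertibility). [folklore] -/
theorem idef_factor_comm (π₁ : F₁ →ₗ[ℝ] F₁') (π₂ : F₂ →ₗ[ℝ] F₂') (P₁ : F₁' →ₗ[ℝ] F₁') (P₂ : F₂' →ₗ[ℝ] F₂') (X' : F₁' →ₗ[ℝ] F₂') (X : F₁ →ₗ[ℝ] F₂) :
    idef (P₁ ∘ₗ π₁) (P₂ ∘ₗ π₂) X' X = (X' ∘ₗ P₁ - P₂ ∘ₗ X') ∘ₗ π₁ + P₂ ∘ₗ idef π₁ π₂ X' X := by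
  ext μ
  simp [idef, map_sub]

/-- The multiplier split: `𝔇_{P₁π₁, P₂π₂}(X′, X) = 𝔇_{π₁, π₂}(X′, X) + (X′(P₁ − 1)π₁ − (P₂ − 1)π₂X)` — the form used at the PROPAGATOR level, where `X′, X` are bounded and
`Pᵢ − 1` is small, so that no derivative of the multiplier appears. [folklore] -/
theorem idef_mul_split (π₁ : F₁ →ₗ[ℝ] F₁') (π₂ : F₂ →ₗ[ℝ] F₂') (P₁ : F₁' →ₗ[ℝ] F₁') (P₂ : F₂' →ₗ[ℝ] F₂') (X' : F₁' →ₗ[ℝ] F₂') (X : F₁ →ₗ[ℝ] F₂) :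
    idef (P₁ ∘ₗ π₁) (P₂ ∘ₗ π₂) X' X = idef π₁ π₂ X' X + (X' ∘ₗ (P₁ - LinearMap.id) ∘ₗ π₁ - (P₂ - LinearMap.id) ∘ₗ π₂ ∘ₗ X) := by
  ext μ
  simp [idef, map_sub]
  abel

end Algebra

/-! ## §2 The staircase holonomy of a site bond field: ν-blind and unitary -/

section Stair

variable (M : Fin (d + 1) → ℕ) (N R : ℕ)

/-- The staircase transporter of a ν-BLIND datum `(μ, q) ↦ F μ q.1` does not depend on the 1-form slot `ν` of the bond point it is read at. [folklore] -/
theorem kingStairT_fst {A : Type} [Monoid A] (F : Fin (d + 1) → Tor (fine N M) → A) (p : Tor (fine N M) × Fin (d + 1)) :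
    kingStairT M N R (fun μ (q : Tor (fine N M) × Fin (d + 1)) => F μ q.1) p = kingStairT M N R (fun μ (q : Tor (fine N M) × Fin (d + 1)) => F μ q.1) (p.1, 0) := rfl

/-- Staircase holonomies of a unitary bond field are unitary (products of unitaries, n15-c `conjTranspose_mprod_mul_self` twice). [folklore] -/
theorem kingStairT_conjTranspose_mul_self {mm : Type} [Fintype mm] [DecidableEq mm] {U : Fin (d + 1) → Tor (fine N M) × Fin (d + 1) → Matrix mm mm ℂ}
    (hU : ∀ μ q, (U μ q)ᴴ * U μ q = 1) (p : Tor (fine N M) × Fin (d + 1)) :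
    (kingStairT M N R U p)ᴴ * kingStairT M N R U p = 1 := by
  unfold kingStairT
  refine conjTranspose_mprod_mul_self fun i hi => ?_
  rw [dif_pos hi]
  unfold kingLineT
  exact conjTranspose_mprod_mul_self fun t _ => hU _ _

end Stair

/-! ## §3 The covariant η-defect is the twist of the flat η-defect of the relatively gauged pair -/

section Twist

variable {ι : Type} [Fintype ι] [DecidableEq ι] {mm : Type} [Fintype mm] [DecidableEq mm] (e : Matrix mm mm ℂ ≃L[ℝ] (ι → ℝ))

omit [NeZero L] in
/-- Dictionary: for a site bond field `U′` on the fine torus, dag-n15-a's covariant pull-back at the datum `cvT e (U′ ∘ fst)` is `M_{Ad(h)ᵀ} ∘ pull`, `h(x′)` the staircase holonomy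
of `U′` from the King base point of `x′` (`kingStairT_conj` + ν-blindness). [cite: Balaban1985Averaging, (125) p.36 (staircase transports, shape); King1986, p.664 (pairing)] -/
theorem ctauV_cvT_eq (mv kk r : ℕ) (hL : Odd L ∧ 1 < L) (U₀' : Fin (d + 1) → ScX' d L mv kk r hL → Matrix mm mm ℂ) :
    ctauV (cvM d L mv kk hL) L kk r (cvT e (fun μ (q : CvX' d L mv kk r hL) => U₀' μ q.1)) =
      mmulOp (fun p' : CvX' d L mv kk r hL => (coordMat e (ContinuousLinearMap.mulLeftRight ℝ (Matrix mm mm ℂ) (kingStairT (cvM d L mv kk hL) (L ^ r * L ^ kk) (L ^ r) (fun μ q => U₀' μ q.1) (p'.1, 0)) (kingStairT (cvM d L mv kk hL) (L ^ r * L ^ kk) (L ^ r) (fun μ q => U₀' μ q.1) (p'.1, 0))ᴴ))ᵀ) ∘ₗ pull (liftMap (kingPrV L kk r (cvM d L mv kk hL)) ι) := by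
  unfold ctauV cvT
  congr 1
  congr 1
  funext p'
  rw [kingStairT_conj, kingStairT_fst]

/-- ★★★ **THE COVARIANT η-DEFECT IS THE TWIST OF A FLAT η-DEFECT**: for Bałaban's full bond operators `A′` (fine, spacing parameter `η′`, mass `a′`) and `A` (coarse), any coarse
bond-point field `U`, and a unitary SITE bond field `U′` on the fine torus with staircase holonomy `h`,
`𝔇_{τ_{U′}}(A′(U′), A(U)) = M_{Ad(h)ᵀ} ∘ 𝔇_{pull}(A′(U′^{h}), A(U))`, `U′^{h}_μ(p) = h(p)U′_μ(p)h(p+e_μ)ᴴ` — the relative axial gauge. (§1 `idef_factor` + n15-c∕330 `cvOp'_gauge` at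
`u := h` + unitarity of `h`.) [cite: Balaban1985BackgroundPropagators, (3.34) p.396, Thm 3.14 pp.426–427 (difference template: shape); Balaban1985Averaging, (125) p.36; King1986, p.664] -/
theorem idef_ctauV_cvOp_eq_twist (mv kk r : ℕ) (hL : Odd L ∧ 1 < L) (a η a' η' : ℝ) (he : ∀ A B : Matrix mm mm ℂ, traceForm A B = e A ⬝ᵥ e B)
    (U : Fin (d + 1) → CvX d L mv kk hL → Matrix mm mm ℂ) {U₀' : Fin (d + 1) → ScX' d L mv kk r hL → Matrix mm mm ℂ} (hU' : ∀ μ x, (U₀' μ x)ᴴ * U₀' μ x = 1) :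
    idef (ctauV (cvM d L mv kk hL) L kk r (cvT e (fun μ (q : CvX' d L mv kk r hL) => U₀' μ q.1))) (ctauV (cvM d L mv kk hL) L kk r (cvT e (fun μ (q : CvX' d L mv kk r hL) => U₀' μ q.1)))
        (covLapM (bshiftEquiv (cvM d L mv kk hL) (L ^ r * L ^ kk)) η' (gaugePair (bshiftEquiv (cvM d L mv kk hL) (L ^ r * L ^ kk)) (fun μ x => coordMat e (ContinuousLinearMap.mulLeftRight ℝ (Matrix mm mm ℂ) ((fun μ (q : CvX' d L mv kk r hL) => U₀' μ q.1) μ x) ((fun μ (q : CvX' d L mv kk r hL) => U₀' μ q.1) μ x)ᴴ))) + (cvNL' d L mv kk r hL a' ι - cvNVq' d L mv kk r hL a' ι e (fun μ (q : CvX' d L mv kk r hL) => U₀' μ q.1) - cvNVr' d L mv kk r hL a' ι e (fun μ (q : CvX' d L mv kk r hL) => U₀' μ q.1)))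
        (covLapM (bshiftEquiv (cvM d L mv kk hL) (L ^ kk)) η (gaugePair (bshiftEquiv (cvM d L mv kk hL) (L ^ kk)) (fun μ x => coordMat e (ContinuousLinearMap.mulLeftRight ℝ (Matrix mm mm ℂ) (U μ x) (U μ x)ᴴ))) + (cvNL d L mv kk hL a ι - cvNVq d L mv kk hL a ι e (U) - cvNVr d L mv kk hL a ι e (U))) =
      mmulOp (fun p' : CvX' d L mv kk r hL => (coordMat e (ContinuousLinearMap.mulLeftRight ℝ (Matrix mm mm ℂ) (kingStairT (cvM d L mv kk hL) (L ^ r * L ^ kk) (L ^ r) (fun μ q => U₀' μ q.1) (p'.1, 0)) (kingStairT (cvM d L mv kk hL) (L ^ r * L ^ kk) (L ^ r) (fun μ q => U₀' μ q.1) (p'.1, 0))ᴴ))ᵀ) ∘ₗ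
        idef (pull (liftMap (kingPrV L kk r (cvM d L mv kk hL)) ι)) (pull (liftMap (kingPrV L kk r (cvM d L mv kk hL)) ι))
          (covLapM (bshiftEquiv (cvM d L mv kk hL) (L ^ r * L ^ kk)) η' (gaugePair (bshiftEquiv (cvM d L mv kk hL) (L ^ r * L ^ kk)) (fun μ x => coordMat e (ContinuousLinearMap.mulLeftRight ℝ (Matrix mm mm ℂ) ((fun μ p => kingStairT (cvM d L mv kk hL) (L ^ r * L ^ kk) (L ^ r) (fun μ q => U₀' μ q.1) (p.1, 0) * U₀' μ p.1 * (kingStairT (cvM d L mv kk hL) (L ^ r * L ^ kk) (L ^ r) (fun μ q => U₀' μ q.1) (((bshiftEquiv (cvM d L mv kk hL) (L ^ r * L ^ kk)) μ p).1, 0))ᴴ) μ x) ((fun μ p => kingStairT (cvM d L mv kk hL) (L ^ r * L ^ kk) (L ^ r) (fun μ q => U₀' μ q.1) (p.1, 0) * U₀' μ p.1 * (kingStairT (cvM d L mv kk hL) (L ^ r * L ^ kk) (L ^ r) (fun μ q => U₀' μ q.1) (((bshiftEquiv (cvM d L mv kk hL) (L ^ r * L ^ kk)) μ p).1, 0))ᴴ)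 μ x)ᴴ))) + (cvNL' d L mv kk r hL a' ι - cvNVq' d L mv kk r hL a' ι e ((fun μ p => kingStairT (cvM d L mv kk hL) (L ^ r * L ^ kk) (L ^ r) (fun μ q => U₀' μ q.1) (p.1, 0) * U₀' μ p.1 * (kingStairT (cvM d L mv kk hL) (L ^ r * L ^ kk) (L ^ r) (fun μ q => U₀' μ q.1) (((bshiftEquiv (cvM d L mv kk hL) (L ^ r * L ^ kk)) μ p).1, 0))ᴴ)) - cvNVr' d L mv kk r hL a' ι e ((fun μ p => kingStairT (cvM d L mv kk hL) (L ^ r * L ^ kk) (L ^ r) (fun μ q => U₀' μ q.1) (p.1, 0) * U₀' μ p.1 * (kingStairT (cvM d L mv kk hL) (L ^ r * L ^ kk) (L ^ r) (fun μ q => U₀' μ q.1) (((bshiftEquiv (cvM d L mv kk hL) (L ^ r * L ^ kk)) μ p).1, 0))ᴴ))))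
          (covLapM (bshiftEquiv (cvM d L mv kk hL) (L ^ kk)) η (gaugePair (bshiftEquiv (cvM d L mv kk hL) (L ^ kk)) (fun μ x => coordMat e (ContinuousLinearMap.mulLeftRight ℝ (Matrix mm mm ℂ) (U μ x) (U μ x)ᴴ))) + (cvNL d L mv kk hL a ι - cvNVq d L mv kk hL a ι e (U) - cvNVr d L mv kk hL a ι e (U))) := by
  have hh : ∀ x' : ScX' d L mv kk r hL, (kingStairT (cvM d L mv kk hL) (L ^ r * L ^ kk) (L ^ r) (fun μ q => U₀' μ q.1) (x', 0))ᴴ * kingStairT (cvM d L mv kk hL) (L ^ r * L ^ kk) (L ^ r) (fun μ q => U₀' μ q.1) (x', 0) = 1 :=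
    fun x' => kingStairT_conjTranspose_mul_self (cvM d L mv kk hL) (L ^ r * L ^ kk) (L ^ r) (fun μ q => hU' μ q.1) (x', 0)
  have hW := fun p' : CvX' d L mv kk r hL => uN_coordMat_conj_orthogonal e he (hh p'.1)
  rw [ctauV_cvT_eq e mv kk r hL U₀', ← cvOp'_gauge e mv kk r hL a' η' he hh (fun μ (q : CvX' d L mv kk r hL) => U₀' μ q.1)]
  exact idef_factor _ _ _ _ _ _ _ (mmulOp_transpose_comp (fun p' : CvX' d L mv kk r hL => coordMat e (ContinuousLinearMap.mulLeftRight ℝ (Matrix mm mm ℂ) (kingStairT (cvM d L mv kk hL) (L ^ r * L ^ kk) (L ^ r) (fun μ q => U₀' μ q.1) (p'.1, 0)) (kingStairT (cvM d L mv kk hL) (L ^ r * L ^ kk) (L ^ r) (fun μ q => U₀' μ q.1) (p'.1, 0))ᴴ)) (fun p' => (hW p').1))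

omit [NeZero L] in
/-- ★★ **THE COMMUTATOR FORM** (any fine transporter datum `T′`, no unitarity): `𝔇_{τ}(A′, A) = (A′M_{Sᵀ} − M_{Sᵀ}A′)∘pull + M_{Sᵀ}∘𝔇_{pull}(A′, A)`, `S = kingStairT … T′` —
the form for smooth cube gauges, where `S − 1` is η-small and the first term is a LOCAL η-small commutator. [cite: Balaban1985BackgroundPropagators, Thm 3.14 pp.426–427 (shape);
King1986, p.664] -/
theorem idef_ctauV_eq_comm (mv kk r : ℕ) (hL : Odd L ∧ 1 < L) (T' : Fin (d + 1) → CvX' d L mv kk r hL → Matrix ι ι ℝ)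
    (X' : (CvX' d L mv kk r hL × ι → ℝ) →ₗ[ℝ] (CvX' d L mv kk r hL × ι → ℝ)) (X : (CvX d L mv kk hL × ι → ℝ) →ₗ[ℝ] (CvX d L mv kk hL × ι → ℝ)) :
    idef (ctauV (cvM d L mv kk hL) L kk r T') (ctauV (cvM d L mv kk hL) L kk r T') X' X =
      (X' ∘ₗ mmulOp (fun p' : CvX' d L mv kk r hL => (kingStairT (cvM d L mv kk hL) (L ^ r * L ^ kk) (L ^ r) T' p')ᵀ) -
          mmulOp (fun p' : CvX' d L mv kk r hL => (kingStairT (cvM d L mv kk hL) (L ^ r * L ^ kk) (L ^ r) T' p')ᵀ) ∘ₗ X') ∘ₗ pull (liftMap (kingPrV L kk r (cvM d L mv kk hL)) ι) +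
        mmulOp (fun p' : CvX' d L mv kk r hL => (kingStairT (cvM d L mv kk hL) (L ^ r * L ^ kk) (L ^ r) T' p')ᵀ) ∘ₗ idef (pull (liftMap (kingPrV L kk r (cvM d L mv kk hL)) ι)) (pull (liftMap (kingPrV L kk r (cvM d L mv kk hL)) ι)) X' X :=
  idef_factor_comm _ _ _ _ _ _

omit [NeZero L] in
/-- ★★ **THE PROPAGATOR-LEVEL FORM**: `𝔇_{τ}(X′, X) = 𝔇_{pull}(X′, X) + (X′(M_{Sᵀ} − 1)pull − (M_{Sᵀ} − 1)pull X)` — for BOUNDED `X′, X` (the propagators and their entries) the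
covariant η-defect is the flat one plus two terms of the size of `S − 1` (`= O(L^r·η′·|A′|) = O(η|A′|)` in a smooth cube gauge), with NO derivative of the staircase field; this —
not the operator-level commutator — is where the O(η) correction of `PCE-DESIGN-g31` §2 (a) is taken. [cite: Balaban1985BackgroundPropagators, Thm 3.14 pp.426–427 (shape); King1986,
Prop. 3.9 (3.73) p.665, p.664] -/
theorem idef_ctauV_eq_flat_add (mv kk r : ℕ) (hL : Odd L ∧ 1 < L) (T' : Fin (d + 1) → CvX' d L mv kk r hL → Matrix ι ι ℝ)
    (X' : (CvX' d L mv kk r hL × ι → ℝ) →ₗ[ℝ] (CvX' d L mv kk r hL × ι → ℝ)) (X : (CvX d L mv kk hL × ι → ℝ) →ₗ[ℝ] (CvX d L mv kk hL × ι → ℝ)) :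
    idef (ctauV (cvM d L mv kk hL) L kk r T') (ctauV (cvM d L mv kk hL) L kk r T') X' X =
      idef (pull (liftMap (kingPrV L kk r (cvM d L mv kk hL)) ι)) (pull (liftMap (kingPrV L kk r (cvM d L mv kk hL)) ι)) X' X +
        (X' ∘ₗ (mmulOp (fun p' : CvX' d L mv kk r hL => (kingStairT (cvM d L mv kk hL) (L ^ r * L ^ kk) (L ^ r) T' p')ᵀ) - LinearMap.id) ∘ₗ pull (liftMap (kingPrV L kk r (cvM d L mv kk hL)) ι) -
          (mmulOp (fun p' : CvX' d L mv kk r hL => (kingStairT (cvM d L mv kk hL) (L ^ r * L ^ kk) (L ^ r) T' p')ᵀ) - LinearMap.id) ∘ₗ pull (liftMap (kingPrV L kk r (cvM d L mv kk hL)) ι) ∘ₗ X) :=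
  idef_mul_split _ _ _ _ _ _

end Twist

/-! ## §5 The per-piece interface of the two-grid random walk: conjugated pieces -/

section Piece

variable {ι : Type} [Fintype ι] [DecidableEq ι]

/-- Dictionary (dag-n15-a's gauge law `ctauV_gauge` inverted): `τ_{T′} = M_{W′ᵀ} ∘ τ_{T′^{W′}} ∘ M_{W′∘σ}` for an orthogonal fine site field `W′` (`σ = kingSec`). [cite: Balaban1985BackgroundPropagators,
(3.31)–(3.32) p.395 (mechanism)] -/
theorem ctauV_eq_conj_gaugeTb (mv kk r : ℕ) (hL : Odd L ∧ 1 < L) (T' : Fin (d + 1) → CvX' d L mv kk r hL → Matrix ι ι ℝ)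
    {W' : ScX' d L mv kk r hL → Matrix ι ι ℝ} (hW'1 : ∀ x, (W' x)ᵀ * W' x = 1) :
    ctauV (cvM d L mv kk hL) L kk r T' = mmulOp (fun p' : CvX' d L mv kk r hL => (W' p'.1)ᵀ) ∘ₗ ctauV (cvM d L mv kk hL) L kk r (gaugeTb (cvM d L mv kk hL) (L ^ r * L ^ kk) W' T') ∘ₗ mmulOp (fun p : CvX d L mv kk hL => W' (kingSec (cvM d L mv kk hL) L kk r p.1)) := by
  rw [CovAvg.ctauV_gauge (cvM d L mv kk hL) L kk r hW'1 T']
  simp only [LinearMap.comp_assoc]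
  rw [mmulOp_transpose_comp (fun p : CvX d L mv kk hL => W' (kingSec (cvM d L mv kk hL) L kk r p.1)) (fun p => hW'1 _), LinearMap.comp_id,
    CurvedSpecies.mmulOp_transpose_comp_cancel (fun p' : CvX' d L mv kk r hL => W' p'.1) (fun p' => hW'1 _)]

/-- ★★★ **THE PER-PIECE INTERFACE OF THE TWO-GRID RANDOM WALK** (memo §5 (2)–(3)): for ANY bounded operators `X′` (fine) and `X` (coarse) — a dressed local propagator of dag-n15-w3's
walk in its cube gauge and its coarse partner — and an orthogonal fine site gauge `W′` with the INDUCED coarse gauge `W′∘σ`, the covariant η-defect of the conjugated pieces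
`M_{W′ᵀ}X′M_{W′}`, `M_{(W′∘σ)ᵀ}XM_{W′∘σ}` is the gauge-twist of «flat defect of `(X′, X)` + two multiplier terms with `S^{W′} − 1`», `S^{W′}` the staircase field of the
gauge-transformed datum `T′^{W′}` (small minus one on the box where `T′^{W′}` is (3.35)-small); no derivative of `S^{W′}` occurs. (§5 dictionary + 330 `idef_conj` + §1
`idef_mul_split`.) [cite: Balaban1985BackgroundPropagators, (3.34)–(3.35) p.396, (3.87)–(3.90) pp.409–410 (the walk: mechanism), Thm 3.14 pp.426–427 (difference template: shape);
King1986, Prop. 3.9 (3.73) p.665, p.664] -/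
theorem idef_ctauV_conj_split (mv kk r : ℕ) (hL : Odd L ∧ 1 < L) (T' : Fin (d + 1) → CvX' d L mv kk r hL → Matrix ι ι ℝ)
    {W' : ScX' d L mv kk r hL → Matrix ι ι ℝ} (hW'1 : ∀ x, (W' x)ᵀ * W' x = 1) (hW'2 : ∀ x, W' x * (W' x)ᵀ = 1)
    (X' : (CvX' d L mv kk r hL × ι → ℝ) →ₗ[ℝ] (CvX' d L mv kk r hL × ι → ℝ)) (X : (CvX d L mv kk hL × ι → ℝ) →ₗ[ℝ] (CvX d L mv kk hL × ι → ℝ)) :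
    idef (ctauV (cvM d L mv kk hL) L kk r T') (ctauV (cvM d L mv kk hL) L kk r T') (mmulOp (fun p' : CvX' d L mv kk r hL => (W' p'.1)ᵀ) ∘ₗ X' ∘ₗ mmulOp (fun p' : CvX' d L mv kk r hL => W' p'.1)) (mmulOp (fun p : CvX d L mv kk hL => (W' (kingSec (cvM d L mv kk hL) L kk r p.1))ᵀ) ∘ₗ X ∘ₗ mmulOp (fun p : CvX d L mv kk hL => W' (kingSec (cvM d L mv kk hL) L kk r p.1))) =
      mmulOp (fun p' : CvX' d L mv kk r hL => (W' p'.1)ᵀ) ∘ₗ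
        (idef (pull (liftMap (kingPrV L kk r (cvM d L mv kk hL)) ι)) (pull (liftMap (kingPrV L kk r (cvM d L mv kk hL)) ι)) X' X +
          (X' ∘ₗ (mmulOp (fun p' : CvX' d L mv kk r hL => (kingStairT (cvM d L mv kk hL) (L ^ r * L ^ kk) (L ^ r) (gaugeTb (cvM d L mv kk hL) (L ^ r * L ^ kk) W' T') p')ᵀ) - LinearMap.id) ∘ₗ pull (liftMap (kingPrV L kk r (cvM d L mv kk hL)) ι) -
            (mmulOp (fun p' : CvX' d L mv kk r hL => (kingStairT (cvM d L mv kk hL) (L ^ r * L ^ kk) (L ^ r) (gaugeTb (cvM d L mv kk hL) (L ^ r * L ^ kk) W' T') p')ᵀ) - LinearMap.id) ∘ₗ pull (liftMap (kingPrV L kk r (cvM d L mv kk hL)) ι) ∘ₗ X)) ∘ₗ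
        mmulOp (fun p : CvX d L mv kk hL => W' (kingSec (cvM d L mv kk hL) L kk r p.1)) := by
  rw [ctauV_eq_conj_gaugeTb mv kk r hL T' hW'1,
    idef_conj _ _ X' X (mmulOp (fun p' : CvX' d L mv kk r hL => (W' p'.1)ᵀ)) (mmulOp (fun p' : CvX' d L mv kk r hL => W' p'.1)) (mmulOp (fun p' : CvX' d L mv kk r hL => (W' p'.1)ᵀ)) (mmulOp (fun p : CvX d L mv kk hL => (W' (kingSec (cvM d L mv kk hL) L kk r p.1))ᵀ)) (mmulOp (fun p : CvX d L mv kk hL => W' (kingSec (cvM d L mv kk hL) L kk r p.1))) (mmulOp (fun p : CvX d L mv kk hL => W' (kingSec (cvM d L mv kk hL) L kk r p.1)))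
      (CurvedSpecies.mmulOp_comp_transpose (fun p' : CvX' d L mv kk r hL => W' p'.1) (fun p' => hW'2 _))
      (CurvedSpecies.mmulOp_comp_transpose (fun p : CvX d L mv kk hL => W' (kingSec (cvM d L mv kk hL) L kk r p.1)) (fun p => hW'2 _))]
  unfold ctauV
  rw [idef_mul_split]

end Piece

end Summit.QuantumFields.YangMills.BalabanUVNodes.N15.Gluing
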